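import Literature.NumberTheory.GaloisRepresentations.LocalGlobalCohomology
import HarnessLib

/-!
# The Tate dual `Hom(M, μ_{p^k})` of a module unramified at `v ∤ p` is unramified at `v`
# (theorems only)

Topic `NumberTheory/GaloisRepresentations`; namespace
`Literature.NumberTheory.GaloisRepresentations.DiscreteGaloisModule`; THEOREMS ONLY (no definition, no
named fact, no `sorry`, no instance).  Lane «SUR-Λ» of cell `bsd-eis` (bookkeeping input `hurD` of
`Greenberg2016.dualSha_torsion_of_poitouTateNatural`), `--supports stmt-BirchSwinnertonDyer-19032`.

For a finite discrete `Γ_K`-module `M` (`σ : DiscreteGaloisModule K M`), a prime `p` and a finite place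
`v` of the number field `K` with `p ∉ v`:

* `mu_apply_eq_self_of_mem_inertia` — inertia at `v` fixes `μ_{p^k}(K̄)` (the tree's
  `smul_eq_self_of_mem_inertia_of_pow_prime_pow_eq_one`, read on the module `mu K (p^k)`);
* **`isUnramifiedAt_tateDual`** — if `σ` is unramified at `v` then so is `σ.tateDual (p^k) =
  Hom(M, μ_{p^k})` (`(γ f)(m) = γ (f (γ⁻¹ m))`, `tateDual_apply_apply_apply`);
* `isUnramifiedOutside_tateDual` — if `σ` is unramified outside `S` and every place above `p` lies
  in `S`, then `σ.tateDual (p^k)` is unramified outside `S`.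

HONESTY: elementary bookkeeping.  AI formalisation, weaker than expert review; the statements are
established only by the kernel check.

## References
* J.-P. Serre, *Abelian ℓ-adic representations and elliptic curves* (1968), Ch. I §1.2 (the
  cyclotomic character is unramified away from `ℓ`). [SerreAbelianLadic1968]
* J. S. Milne, *Arithmetic Duality Theorems*, 2nd ed. (2006), I §0–§2 (the module `M^D`). [MilneADT2006]
-/

noncomputable section

open Function NumberField IsDedekindDomain Field

namespace Literature.NumberTheory.GaloisRepresentations.DiscreteGaloisModule

variable {K : Type} [Field K] [NumberField K] {M : Type} [AddCommGroup M] [TopologicalSpace M]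
  [DiscreteTopology M] [Finite M] (σ : DiscreteGaloisModule K M) {p : ℕ} [Fact p.Prime]

omit [Finite M] in
/-- **Inertia at `v ∤ p` fixes `μ_{p^k}(K̄)`** (on the module `mu K (p^k)`).
[cite: SerreAbelianLadic1968, Ch. I §1.2 (Example: the cyclotomic character)] -/
theorem mu_apply_eq_self_of_mem_inertia {v : HeightOneSpectrum (𝓞 K)} (hv : (p : 𝓞 K) ∉ v.asIdeal)
    {𝔓 : Ideal (absIntegers (𝓞 K) K)} (h𝔓 : 𝔓 ∈ v.primesAbove)
    {γ : absoluteGaloisGroup K} (hγ : γ ∈ 𝔓.inertia (absoluteGaloisGroup K)) (k : ℕ)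
    (ζ : MuCarrier K (p ^ k)) : mu K (p ^ k) γ ζ = ζ := by
  have ht : (((Additive.toMul (MuCarrier.toAdditive ζ) : rootsOfUnity (p ^ k) (AlgebraicClosure K)) :
      (AlgebraicClosure K)ˣ) : AlgebraicClosure K) ^ p ^ k = 1 := by
    have h2 := (Additive.toMul (MuCarrier.toAdditive ζ)).2
    rw [mem_rootsOfUnity] at h2
    rw [← Units.val_pow_eq_pow_val, h2, Units.val_one]
  change Additive.ofMul (γ • Additive.toMul (MuCarrier.toAdditive ζ)) =
    Additive.ofMul (Additive.toMul (MuCarrier.toAdditive ζ))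
  refine congrArg Additive.ofMul (Subtype.ext (Units.ext ?_))
  rw [absoluteGaloisGroup.coe_smul_rootsOfUnity, Units.coe_smul]
  exact smul_eq_self_of_mem_inertia_of_pow_prime_pow_eq_one hv h𝔓 hγ ht

/-- **`Hom(M, μ_{p^k})` is unramified at `v ∤ p` when `M` is**: for `γ` in an inertia group above `v`,
`(γ f)(m) = γ (f (γ⁻¹ m)) = f m`. [cite: MilneADT2006, Ch. I §0 (the module `M^D`)]
[cite: SerreAbelianLadic1968, Ch. I §1.2] -/
theorem isUnramifiedAt_tateDual {v : HeightOneSpectrum (𝓞 K)} (hv : (p : 𝓞 K) ∉ v.asIdeal)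
    (hσ : GaloisRep.IsUnramifiedAt v σ) (k : ℕ) : GaloisRep.IsUnramifiedAt v (σ.tateDual (p ^ k)) := by
  rw [GaloisRep.isUnramifiedAt_iff] at hσ ⊢
  intro 𝔓 h𝔓 γ hγ
  have h1 : σ γ⁻¹ = 1 := hσ 𝔓 h𝔓 γ⁻¹ (inv_mem hγ)
  refine LinearMap.ext fun f => ?_
  refine TateDual.ext fun m => ?_
  rw [tateDual_apply_apply_apply, h1, Module.End.one_apply, Module.End.one_apply]
  exact mu_apply_eq_self_of_mem_inertia hv h𝔓 hγ k (f m)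

/-- **`Hom(M, μ_{p^k})` is unramified outside `S` when `M` is and `S` contains the places above `p`.**
[cite: MilneADT2006, Ch. I §0 (the module `M^D`)] -/
theorem isUnramifiedOutside_tateDual {S : Set (HeightOneSpectrum (𝓞 K))}
    (hSp : ∀ w : HeightOneSpectrum (𝓞 K), ((p : ℕ) : 𝓞 K) ∈ w.asIdeal → w ∈ S)
    (hσ : GaloisRep.IsUnramifiedOutside S σ) (k : ℕ) :
    GaloisRep.IsUnramifiedOutside S (σ.tateDual (p ^ k)) :=
  fun w hw => isUnramifiedAt_tateDual σ (fun h => hw (hSp w h)) (hσ w hw) k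

end Literature.NumberTheory.GaloisRepresentations.DiscreteGaloisModule

/-! ## General level `n`: `Hom(M, μₙ)` is unramified at `v ∤ n`

(Appended; lane «PT-Ш-S-TC» of cell `bsd-eis`, brick D5c: the named fact
`poitouTate_shaRestricted_tateDual_natural(_at)` quantifies over every level `n ≥ 1` with "`v ∣ n ⇒ v ∈ S`",
and the comparison `Ext²(M^D, Ē_S) ≅ H²(G_S, ·)` needs `N_S ≤ ker (ρ.tateDual n)`.)  The prime-power proofs
above use primality only to pass from `ℓ^k ∈ 𝔓` to `ℓ ∈ 𝔓`; for a general `n` with `n ∉ v` the same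
argument (distinct `n`-th roots of unity stay distinct modulo `𝔓 ∤ n`) applies verbatim. -/

namespace Literature.NumberTheory.GaloisRepresentations

/-- **Inertia prime to `n` fixes the `n`-th roots of unity** (any `n ≥ 1` with `n ∉ v`): for `𝔓` above `v`,
`σ ∈ I_𝔓` and `t ∈ K̄` with `t ^ n = 1`, `σ t = t` — if `σ t ≠ t` then `0 = ((σt)^n - t^n)/(σt - t) ≡ n t^{n-1}
(mod 𝔓)` forces `n ∈ 𝔓 ∩ 𝓞 K = v`.  (The tree's `smul_eq_self_of_mem_inertia_of_pow_prime_pow_eq_one` is the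
case `n = ℓ^k`.) [cite: SerreAbelianLadic1968, Ch. I §1.2 (Example: the cyclotomic character)] -/
theorem smul_eq_self_of_mem_inertia_of_pow_eq_one_of_not_mem {K : Type*} [Field K] [NumberField K]
    {v : HeightOneSpectrum (𝓞 K)} {N : ℕ} (hN : 0 < N) (hv : (N : 𝓞 K) ∉ v.asIdeal)
    {𝔓 : Ideal (absIntegers (𝓞 K) K)} (h𝔓 : 𝔓 ∈ v.primesAbove)
    {σ : absoluteGaloisGroup K} (hσ : σ ∈ 𝔓.inertia (absoluteGaloisGroup K))
    {t : AlgebraicClosure K} (ht : t ^ N = 1) : σ • t = t := by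
  haveI : 𝔓.IsPrime := h𝔓.1
  -- `t` is an algebraic integer, `x = t ∈ \bar ℤ_K`, `y = σ x`
  have hti : IsIntegral (𝓞 K) t :=
    IsIntegral.of_pow hN (by rw [ht]; exact isIntegral_one)
  set x : absIntegers (𝓞 K) K := ⟨t, hti⟩
  have hxt : (x : AlgebraicClosure K) = t := rfl
  have hxN : x ^ N = 1 := Subtype.ext (by simp [hxt, ht])
  set y : absIntegers (𝓞 K) K := σ • x with hy
  have hyN : y ^ N = 1 := by rw [hy, ← smul_pow', hxN, smul_one]
  have hyx : y - x ∈ 𝔓 := hσ x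
  suffices h : y = x by
    have := congrArg (fun z : absIntegers (𝓞 K) K => (z : AlgebraicClosure K)) h
    simpa [hy, hxt, integralClosure.coe_smul] using this
  by_contra hne
  -- the geometric sum `∑ yⁱ x^{N-1-i}` vanishes since `y ≠ x` are both `N`-th roots of unity
  have hgeom : (∑ i ∈ Finset.range N, y ^ i * x ^ (N - 1 - i)) = 0 := by
    have h := geom_sum₂_mul y x N
    rw [hyN, hxN, sub_self] at h
    exact (mul_eq_zero.mp h).resolve_right (sub_ne_zero.mpr hne)
  -- reduce modulo `𝔓`: `y ≡ x`, so the sum is `≡ N x^{N-1}`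
  set π := Ideal.Quotient.mk 𝔓
  have hπyx : π y = π x := (Ideal.Quotient.eq).mpr hyx
  have h1 : (N : absIntegers (𝓞 K) K ⧸ 𝔓) * π x ^ (N - 1) = 0 := by
    have := congrArg π hgeom
    rwa [RingHom.map_geom_sum₂, map_zero, hπyx, geom_sum₂_self] at this
  have hπxN : π x ^ N = 1 := by rw [← map_pow, hxN, map_one]
  have hxunit : π x ^ (N - 1) ≠ 0 := by
    intro h0
    have : π x = 0 := eq_zero_of_pow_eq_zero h0
    rw [this, zero_pow hN.ne'] at hπxN
    exact zero_ne_one hπxN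
  have hN0 : (N : absIntegers (𝓞 K) K ⧸ 𝔓) = 0 :=
    (mul_eq_zero.mp h1).resolve_right hxunit
  -- hence `N ∈ 𝔓 ∩ 𝓞 K = v`, contradiction
  have hNmem : ((N : 𝓞 K) : 𝓞 K) ∈ v.asIdeal := by
    rw [h𝔓.2.over, Ideal.mem_under, map_natCast, ← Ideal.Quotient.eq_zero_iff_mem, map_natCast]
    exact hN0
  exact hv hNmem

namespace DiscreteGaloisModule

variable {K : Type} [Field K] [NumberField K] {M : Type} [AddCommGroup M] [TopologicalSpace M]
  [DiscreteTopology M] [Finite M] (σ : DiscreteGaloisModule K M) {n : ℕ} [NeZero n]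

omit [Finite M] in
/-- **Inertia at `v ∤ n` fixes `μₙ(K̄)`** (on the module `mu K n`), any level `n ≥ 1`.
[cite: SerreAbelianLadic1968, Ch. I §1.2 (Example: the cyclotomic character)] -/
theorem mu_apply_eq_self_of_mem_inertia_of_not_mem {v : HeightOneSpectrum (𝓞 K)} (hv : (n : 𝓞 K) ∉ v.asIdeal)
    {𝔓 : Ideal (absIntegers (𝓞 K) K)} (h𝔓 : 𝔓 ∈ v.primesAbove)
    {γ : absoluteGaloisGroup K} (hγ : γ ∈ 𝔓.inertia (absoluteGaloisGroup K))
    (ζ : MuCarrier K n) : mu K n γ ζ = ζ := by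
  have ht : (((Additive.toMul (MuCarrier.toAdditive ζ) : rootsOfUnity n (AlgebraicClosure K)) :
      (AlgebraicClosure K)ˣ) : AlgebraicClosure K) ^ n = 1 := by
    have h2 := (Additive.toMul (MuCarrier.toAdditive ζ)).2
    rw [mem_rootsOfUnity] at h2
    rw [← Units.val_pow_eq_pow_val, h2, Units.val_one]
  change Additive.ofMul (γ • Additive.toMul (MuCarrier.toAdditive ζ)) =
    Additive.ofMul (Additive.toMul (MuCarrier.toAdditive ζ))
  refine congrArg Additive.ofMul (Subtype.ext (Units.ext ?_))
  rw [absoluteGaloisGroup.coe_smul_rootsOfUnity, Units.coe_smul]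
  exact smul_eq_self_of_mem_inertia_of_pow_eq_one_of_not_mem (Nat.pos_of_ne_zero (NeZero.ne n)) hv h𝔓 hγ ht

/-- **`Hom(M, μₙ)` is unramified at `v ∤ n` when `M` is**, any level `n ≥ 1`: for `γ` in an inertia group
above `v`, `(γ f)(m) = γ (f (γ⁻¹ m)) = f m`. [cite: MilneADT2006, Ch. I §0 (the module `M^D`)]
[cite: SerreAbelianLadic1968, Ch. I §1.2] -/
theorem isUnramifiedAt_tateDual_of_not_mem {v : HeightOneSpectrum (𝓞 K)} (hv : (n : 𝓞 K) ∉ v.asIdeal)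
    (hσ : GaloisRep.IsUnramifiedAt v σ) : GaloisRep.IsUnramifiedAt v (σ.tateDual n) := by
  rw [GaloisRep.isUnramifiedAt_iff] at hσ ⊢
  intro 𝔓 h𝔓 γ hγ
  have h1 : σ γ⁻¹ = 1 := hσ 𝔓 h𝔓 γ⁻¹ (inv_mem hγ)
  refine LinearMap.ext fun f => ?_
  refine TateDual.ext fun m => ?_
  rw [tateDual_apply_apply_apply, h1, Module.End.one_apply, Module.End.one_apply]
  exact mu_apply_eq_self_of_mem_inertia_of_not_mem hv h𝔓 hγ (f m)

/-- **`Hom(M, μₙ)` is unramified outside `S` when `M` is and `S` contains the places dividing `n`**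
(any level `n ≥ 1`; the hypothesis "`v ∣ n ⇒ v ∈ S`" of `poitouTate_shaRestricted_tateDual(_natural)`).
[cite: MilneADT2006, Ch. I §0 (the module `M^D`)] -/
theorem isUnramifiedOutside_tateDual_of_forall_mem {S : Set (HeightOneSpectrum (𝓞 K))}
    (hn : ∀ w : HeightOneSpectrum (𝓞 K), ((n : ℕ) : 𝓞 K) ∈ w.asIdeal → w ∈ S)
    (hσ : GaloisRep.IsUnramifiedOutside S σ) : GaloisRep.IsUnramifiedOutside S (σ.tateDual n) :=
  fun w hw => isUnramifiedAt_tateDual_of_not_mem σ (fun h => hw (hn w h)) (hσ w hw)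

end DiscreteGaloisModule

end Literature.NumberTheory.GaloisRepresentations

/-! ## Any level `n`, torsion exponent `d`: `Hom(M, μₙ)` is unramified at `v ∤ d` when `d • M = 0`

(Appended; lane «PT-Ш-S-TC», brick D5c.)  The admissibility hypothesis of
`poitouTate_shaRestricted_tateDual_natural(_at)` is "`v ∣ #M ⇒ v ∈ S`", not "`v ∣ n ⇒ v ∈ S`": for `M`
killed by `d` (e.g. `d = #M`) every value `ψ(m) ∈ μₙ` of `ψ ∈ Hom(M, μₙ)` satisfies `ψ(m)^d = 1`, so inertia
at `v ∤ d` fixes it, whatever `n` is. -/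

namespace Literature.NumberTheory.GaloisRepresentations.DiscreteGaloisModule

variable {K : Type} [Field K] [NumberField K] {M : Type} [AddCommGroup M] [TopologicalSpace M]
  [DiscreteTopology M] [Finite M] (σ : DiscreteGaloisModule K M) {n : ℕ}

omit [Finite M] in
/-- **Inertia at `v ∤ d` fixes every `ζ ∈ μₙ(K̄)` with `d • ζ = 0`** (on the module `mu K n`).
[cite: SerreAbelianLadic1968, Ch. I §1.2 (Example: the cyclotomic character)] -/
theorem mu_apply_eq_self_of_mem_inertia_of_nsmul_eq_zero {d : ℕ} (hd0 : 0 < d)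
    {v : HeightOneSpectrum (𝓞 K)} (hv : (d : 𝓞 K) ∉ v.asIdeal)
    {𝔓 : Ideal (absIntegers (𝓞 K) K)} (h𝔓 : 𝔓 ∈ v.primesAbove)
    {γ : absoluteGaloisGroup K} (hγ : γ ∈ 𝔓.inertia (absoluteGaloisGroup K))
    (ζ : MuCarrier K n) (hζ : d • ζ = 0) : mu K n γ ζ = ζ := by
  have h2 : (Additive.toMul (MuCarrier.toAdditive ζ) : rootsOfUnity n (AlgebraicClosure K)) ^ d = 1 := by
    rw [← toMul_nsmul, ← map_nsmul, hζ, map_zero, toMul_zero]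
  have ht : (((Additive.toMul (MuCarrier.toAdditive ζ) : rootsOfUnity n (AlgebraicClosure K)) :
      (AlgebraicClosure K)ˣ) : AlgebraicClosure K) ^ d = 1 := by
    rw [← Units.val_pow_eq_pow_val, ← Subgroup.coe_pow, h2, Subgroup.coe_one, Units.val_one]
  change Additive.ofMul (γ • Additive.toMul (MuCarrier.toAdditive ζ)) =
    Additive.ofMul (Additive.toMul (MuCarrier.toAdditive ζ))
  refine congrArg Additive.ofMul (Subtype.ext (Units.ext ?_))
  rw [absoluteGaloisGroup.coe_smul_rootsOfUnity, Units.coe_smul]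
  exact smul_eq_self_of_mem_inertia_of_pow_eq_one_of_not_mem hd0 hv h𝔓 hγ ht

/-- **`Hom(M, μₙ)` is unramified at `v ∤ d` when `M` is unramified at `v` and `d • M = 0`** — ANY level
`n`: for `γ` in an inertia group above `v`, `(γ f)(m) = γ (f (γ⁻¹ m)) = γ (f m) = f m` since
`(f m)^d = f(d m) = 1`. [cite: MilneADT2006, Ch. I §0 (the module `M^D`)] [cite: SerreAbelianLadic1968, Ch. I §1.2] -/
theorem isUnramifiedAt_tateDual_of_nsmul_eq_zero {d : ℕ} (hd0 : 0 < d) (hd : ∀ m : M, d • m = 0)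
    {v : HeightOneSpectrum (𝓞 K)} (hv : (d : 𝓞 K) ∉ v.asIdeal) (hσ : GaloisRep.IsUnramifiedAt v σ)
    (n : ℕ) : GaloisRep.IsUnramifiedAt v (σ.tateDual n) := by
  rw [GaloisRep.isUnramifiedAt_iff] at hσ ⊢
  intro 𝔓 h𝔓 γ hγ
  have h1 : σ γ⁻¹ = 1 := hσ 𝔓 h𝔓 γ⁻¹ (inv_mem hγ)
  refine LinearMap.ext fun f => ?_
  refine TateDual.ext fun m => ?_
  rw [tateDual_apply_apply_apply, h1, Module.End.one_apply, Module.End.one_apply]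
  have hfm : f (d • m) = d • f m := map_nsmul f d m
  rw [hd, map_zero] at hfm
  exact mu_apply_eq_self_of_mem_inertia_of_nsmul_eq_zero hd0 hv h𝔓 hγ (f m) hfm.symm

/-- **`Hom(M, μₙ)` is unramified outside `S` when `M` is, `d • M = 0` and `S` contains the places dividing
`d`** (any level `n`). [cite: MilneADT2006, Ch. I §0 (the module `M^D`)] -/
theorem isUnramifiedOutside_tateDual_of_nsmul_eq_zero {d : ℕ} (hd0 : 0 < d) (hd : ∀ m : M, d • m = 0)
    {S : Set (HeightOneSpectrum (𝓞 K))}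
    (hdS : ∀ w : HeightOneSpectrum (𝓞 K), ((d : ℕ) : 𝓞 K) ∈ w.asIdeal → w ∈ S)
    (hσ : GaloisRep.IsUnramifiedOutside S σ) (n : ℕ) : GaloisRep.IsUnramifiedOutside S (σ.tateDual n) :=
  fun w hw => isUnramifiedAt_tateDual_of_nsmul_eq_zero σ hd0 hd (fun h => hw (hdS w h)) (hσ w hw) n

/-- **`Hom(M, μₙ)` is unramified outside `S` when `M` is and `S` contains the places dividing `#M`** (any
level `n`) — the admissibility hypothesis "`v ∣ #M ⇒ v ∈ S`" of `poitouTate_shaRestricted_tateDual(_natural)`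
verbatim. [cite: MilneADT2006, Ch. I §0 (the module `M^D`) and I Thm. 4.10] -/
theorem isUnramifiedOutside_tateDual_of_natCard {S : Set (HeightOneSpectrum (𝓞 K))}
    (hS : ∀ w : HeightOneSpectrum (𝓞 K), ((Nat.card M : ℕ) : 𝓞 K) ∈ w.asIdeal → w ∈ S)
    (hσ : GaloisRep.IsUnramifiedOutside S σ) (n : ℕ) : GaloisRep.IsUnramifiedOutside S (σ.tateDual n) :=
  isUnramifiedOutside_tateDual_of_nsmul_eq_zero σ Nat.card_pos (fun _ => card_nsmul_eq_zero') hS hσ n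

end Literature.NumberTheory.GaloisRepresentations.DiscreteGaloisModule
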